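import Mathlib.Topology.Instances.Shrink
import Mathlib.Data.Countable.Small
import Literature.Topology.FourManifolds.HomotopyS4CompactProofs
import Literature.AlgebraicTopology.SingularHomology.LocalHomologyIso
import HarnessLib

/-!
# A manifold with a contractible point-complement is compact (Hatcher Prop. 3.29 + §3.3)

Sibling of `Literature/Topology/FourManifolds/HomotopyS4Compact(Proofs).lean` (same sources, same
method). It serves the reduction, in `Literature/Geometry/Symplectic/GromovR4Proofs.lean`, of the named
fact `Literature.Geometry.Symplectic.gromov_puncturedStandard_diffeomorphic_R4` (`GromovR4.lean`: a CONTRACTIBLE punctured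
smooth 4-manifold `M ∖ {p}` carrying a symplectic form standard near `p` is diffeomorphic to `ℝ⁴`) to
the printed recognition theorem `Literature.Geometry.Symplectic.gromov_recognitionR4_relEnd` (`GromovR4RelEnd.lean`;
Gromov 1985, §0.3.C, McDuff–Salamon 2017, Rem. 4.5.2 (viii)), whose hypothesis "symplectomorphic to
`(ℝ⁴, ω₀)` outside a COMPACT subset" requires `M` to be compact. Compactness of `M` is forced by the
contractibility of `M ∖ {p}`, through singular homology (A. Hatcher, *Algebraic Topology*, CUP 2002):

* `M ∖ {p}` is contractible, hence connected, and dense in `M` (a point of an `n`-manifold, `n ≥ 1`,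
  is not open), so `M` is connected (`Literature.Topology.FourManifolds.connectedSpace_of_contractibleSpace_compl_singleton`);
* if `M` were not compact, `Hₙ(M; ℤ) = 0` (Prop. 3.29, PROVED in the tree:
  `Literature.AlgebraicTopology.SingularHomology.isZero_singularHomology_of_noncompactSpace_holds`, `…SingularHomology.NoncompactManifoldProofs`);
* then in the long exact sequence of the pair `(M, M ∖ {p})` (Thm. 2.16 ff.,
  `…SingularHomology.RelativeHomology`) the connecting map `∂ : Hₙ(M, M ∖ {p}) → Hₙ₋₁(M ∖ {p})` is
  injective and zero — its target vanishes for `n ≥ 2` (contractible, Cor. 2.11) and for `n = 1` it is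
  followed by the injective `H₀(M ∖ {p}) → H₀(M)` (Prop. 2.7) — so `Hₙ(M, M ∖ {p}; ℤ) = 0`;
* but the local homology of an `n`-manifold is `Hₙ(M | p; ℤ) ≅ ℤ` (§3.3, p. 231; PROVED in the tree:
  `Literature.AlgebraicTopology.SingularHomology.nonempty_localHomology_iso_holds`, `…SingularHomology.LocalHomologyIso`). Contradiction.

The homological layer lives in `Type`; a second-countable Hausdorff `M : Type u` is first replaced by
its small copy `Shrink.{0} M` (`Literature.Topology.FourManifolds.small_of_secondCountableTopology`, as in `HomotopyS4CompactProofs`).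
Everything is proved; there are no definitions and no named facts.

## Main statements

* `Literature.Topology.FourManifolds.not_isOpen_singleton_of_chartedSpace`: no point of a space charted on `ℝⁿ`, `n ≥ 1`, is open.
* `Literature.Topology.FourManifolds.connectedSpace_of_contractibleSpace_compl_singleton`: `M ∖ {p}` contractible ⟹ `M` connected.
* `Literature.Topology.FourManifolds.compactSpace_of_contractibleSpace_compl_singleton`: for `n ≥ 1` and a Hausdorff
  second-countable `M : Type u` charted on `ℝⁿ`, `M ∖ {p}` contractible ⟹ `M` compact.

## References

* A. Hatcher, *Algebraic Topology*, CUP 2002, Prop. 3.29 (p. 239), §3.3 (p. 231: local homology of a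
  manifold), Thm. 2.16 ff. (long exact sequence of a pair), Prop. 2.7, Cor. 2.11 [HatcherAT2002].
-/

noncomputable section

open CategoryTheory Limits Set Topology Filter

universe u

namespace Literature.Topology.FourManifolds

/-- No point of a space charted on `ℝⁿ`, `n ≥ 1`, is open: its image under a chart would be an open
point of `ℝⁿ` (Hatcher 2002, p. 231: manifolds are locally Euclidean). [folklore] -/
theorem not_isOpen_singleton_of_chartedSpace {n : ℕ} (hn : 1 ≤ n) {M : Type u} [TopologicalSpace M]
    [ChartedSpace (EuclideanSpace ℝ (Fin n)) M] (p : M) : ¬ IsOpen ({p} : Set M) := by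
  intro hp
  set e := chartAt (EuclideanSpace ℝ (Fin n)) p with he
  have himg : IsOpen (e '' {p}) :=
    e.isOpen_image_of_subset_source hp (singleton_subset_iff.2 (mem_chart_source _ p))
  rw [image_singleton] at himg
  haveI : Nontrivial (EuclideanSpace ℝ (Fin n)) :=
    Module.nontrivial_of_finrank_pos (R := ℝ) (by rw [finrank_euclideanSpace_fin]; exact hn)
  haveI : NeBot (𝓝[≠] (e p)) := Module.punctured_nhds_neBot ℝ (EuclideanSpace ℝ (Fin n)) (e p)
  exact (NeBot.ne inferInstance) ((isOpen_singleton_iff_punctured_nhds (e p)).1 himg)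

/-- If the complement of a point of a space charted on `ℝⁿ`, `n ≥ 1`, is contractible, the space is
connected: `M ∖ {p}` is connected and dense. [folklore] -/
theorem connectedSpace_of_contractibleSpace_compl_singleton {n : ℕ} (hn : 1 ≤ n) {M : Type u}
    [TopologicalSpace M] [ChartedSpace (EuclideanSpace ℝ (Fin n)) M] (p : M)
    [ContractibleSpace ({p}ᶜ : Set M)] : ConnectedSpace M := by
  have h1 : IsConnected ({p}ᶜ : Set M) := isConnected_iff_connectedSpace.2 inferInstance
  have h2 : Dense ({p}ᶜ : Set M) :=
    dense_compl_singleton_iff_not_open.2 (not_isOpen_singleton_of_chartedSpace hn p)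
  have h3 : IsConnected (univ : Set M) := by
    rw [← h2.closure_eq]
    exact h1.closure
  exact connectedSpace_iff_univ.2 h3

/-- The homological core, for spaces in `Type` (the universe of the `Literature` singular-homology
computations): a Hausdorff space `M` charted on `ℝᵏ⁺¹` whose point-complement `M ∖ {p}` is
contractible is compact. If not, `Hₖ₊₁(M; ℤ) = 0` (Hatcher 2002, Prop. 3.29), so
`∂ : Hₖ₊₁(M, M ∖ p) → Hₖ(M ∖ p)` is injective; it is also zero (`Hₖ(M ∖ p) = 0` for `k ≥ 1`,
`H₀(M ∖ p) ↪ H₀(M)` for `k = 0`), whence `Hₖ₊₁(M | p; ℤ) = 0`, contradicting `Hₖ₊₁(M | p; ℤ) ≅ ℤ`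
(§3.3). [cite: HatcherAT2002, Prop. 3.29 and §3.3] -/
theorem compactSpace_of_contractibleSpace_compl_singleton_of_type {k : ℕ} (M : Type)
    [TopologicalSpace M] [T2Space M] [ChartedSpace (EuclideanSpace ℝ (Fin (k + 1))) M] (p : M)
    [ContractibleSpace ({p}ᶜ : Set M)] : CompactSpace M := by
  by_contra hM
  haveI : NoncompactSpace M := not_compactSpace_iff.mp hM
  haveI : ConnectedSpace M := connectedSpace_of_contractibleSpace_compl_singleton k.succ_pos p
  -- Prop. 3.29: the top homology of the connected non-compact manifold `M` vanishes
  have hMz : IsZero (Literature.AlgebraicTopology.SingularHomology.singularHomology ℤ ℤ M (k + 1)) :=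
    Literature.AlgebraicTopology.SingularHomology.isZero_singularHomology_of_noncompactSpace_holds ℤ M (k + 1) le_rfl
  -- hence `∂ : Hₖ₊₁(M, M ∖ p) ⟶ Hₖ(M ∖ p)` is a monomorphism
  haveI : Mono (Literature.AlgebraicTopology.SingularHomology.relativeSingularHomology.δ ℤ ℤ M ({p}ᶜ : Set M) k) :=
    (Literature.AlgebraicTopology.SingularHomology.relativeSingularHomology.exact_ofAbsolute_δ ℤ ℤ ({p}ᶜ : Set M) k).mono_g (hMz.eq_of_src _ _)
  -- and it is zero
  have hδ : Literature.AlgebraicTopology.SingularHomology.relativeSingularHomology.δ ℤ ℤ M ({p}ᶜ : Set M) k = 0 := by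
    rcases Nat.eq_zero_or_pos k with rfl | hk
    · haveI := Literature.AlgebraicTopology.SingularHomology.singularHomology.mono_map_zero_of_pathConnectedSpace ℤ ℤ
        (⟨Subtype.val, continuous_subtype_val⟩ : C(↥({p}ᶜ : Set M), M))
      exact zero_of_comp_mono _ (Literature.AlgebraicTopology.SingularHomology.relativeSingularHomology.δ_comp_map ℤ ℤ ({p}ᶜ : Set M) 0)
    · exact (Literature.AlgebraicTopology.SingularHomology.isZero_singularHomology_of_contractibleSpace ℤ ℤ (X := ↥({p}ᶜ : Set M)) hk.ne').eq_of_tgt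
        _ _
  -- so the local homology `Hₖ₊₁(M | p; ℤ)` vanishes, contradicting `Hₖ₊₁(M | p; ℤ) ≅ ℤ`
  have hz : IsZero (Literature.AlgebraicTopology.SingularHomology.localHomology ℤ ℤ M p (k + 1)) := IsZero.of_mono_eq_zero _ hδ
  obtain ⟨i⟩ := Literature.AlgebraicTopology.SingularHomology.nonempty_localHomology_iso_holds ℤ M (n := k + 1) p
  have hs : Subsingleton (ULift.{0} ℤ) :=
    ModuleCat.isZero_of_iff_subsingleton.mp (hz.of_iso i.symm)
  exact absurd (hs.elim (ULift.up 0) (ULift.up 1)) (by simp)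

/-- **A manifold with a contractible point-complement is compact.** For `n ≥ 1` and a Hausdorff,
second-countable topological space `M` locally homeomorphic to `ℝⁿ` (charted on
`EuclideanSpace ℝ (Fin n)`), if `M ∖ {p}` is contractible for some `p ∈ M` then `M` is compact
(Hatcher 2002, Prop. 3.29 with the local homology `Hₙ(M | p) ≅ ℤ` of §3.3 and the long exact
sequence of the pair `(M, M ∖ {p})`; `compactSpace_of_contractibleSpace_compl_singleton_of_type` run on
the small copy `Shrink.{0} M`). [cite: HatcherAT2002, Prop. 3.29 and §3.3] -/
theorem compactSpace_of_contractibleSpace_compl_singleton {n : ℕ} (hn : 1 ≤ n) (M : Type u)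
    [TopologicalSpace M] [T2Space M] [SecondCountableTopology M]
    [ChartedSpace (EuclideanSpace ℝ (Fin n)) M] (p : M) (hc : ContractibleSpace ({p}ᶜ : Set M)) :
    CompactSpace M := by
  obtain ⟨k, rfl⟩ : ∃ k, n = k + 1 := ⟨n - 1, by omega⟩
  haveI : Small.{0} M := small_of_secondCountableTopology M
  let φ : M ≃ₜ Shrink.{0} M := Shrink.homeomorph M
  haveI : T2Space (Shrink.{0} M) := φ.t2Space
  letI : ChartedSpace M (Shrink.{0} M) :=
    φ.symm.toOpenPartialHomeomorph.singletonChartedSpace rfl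
  letI : ChartedSpace (EuclideanSpace ℝ (Fin (k + 1))) (Shrink.{0} M) :=
    ChartedSpace.comp (EuclideanSpace ℝ (Fin (k + 1))) M (Shrink.{0} M)
  let e : ({p}ᶜ : Set M) ≃ₜ ({φ p}ᶜ : Set (Shrink.{0} M)) :=
    φ.subtype (p := fun x => x ∈ ({p}ᶜ : Set M)) (q := fun y => y ∈ ({φ p}ᶜ : Set (Shrink.{0} M)))
      (fun x => by simp)
  haveI : ContractibleSpace ({φ p}ᶜ : Set (Shrink.{0} M)) := e.symm.contractibleSpace
  haveI : CompactSpace (Shrink.{0} M) :=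
    compactSpace_of_contractibleSpace_compl_singleton_of_type (k := k) (Shrink.{0} M) (φ p)
  exact φ.symm.compactSpace

end Literature.Topology.FourManifolds

end
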